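import Literature.Probability.LatticeModels.DobrushinMetricStates
import Literature.Probability.LatticeModels.ONModelDobrushinStates
import Mathlib.Analysis.SpecificLimits.Basic
import HarnessLib

/-!
# Dobrushin's comparison of two finite-volume kernels with different boundary conditions,
# Vasserstein form (Föllmer 1988 Ch. I, Lemma (2.5), (2.8) and the conditional specification (2.10))

`DobrushinComparisonMetric.lean` compares two INVARIANT states of the single-site averaging
operators usable on a set `W`, starting from the constant estimate `R` and concluding in the
geometric/profile form (`abs_sub_le_sum_pow`). Dobrushin's original use of the technique
(1970, Thm. 3) — and Föllmer's conditional specification (2.10) — compare the two FINITE-VOLUME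
kernels `γ_Λ(· | ω)`, `γ_Λ(· | η)` of ONE specification with boundary conditions differing at a
single exterior site `y ∉ Λ`: both are invariant under the one-site kernels `γ_x`, `x ∈ Λ`
(consistency of the specification), the exterior site `y` is never swept, and its coefficient in
the estimate is `r(ω_y, η_y)` — NOT the uniform bound `R` — from the start. This file proves that
refinement:

* abstract (`DobrushinMetric.DustingData`): the Föllmer sweep from ANY nonnegative initial estimate
  `a₀` down to any SUPER-SOLUTION `a⋆ ≥ 0` of `(C a⋆)_x ≤ a⋆_x` (`x ∈ W`) dominating `a₀` up to
  `M·𝟙_W`, when the `W`-restricted row sums are `≤ c < 1`: `|E₁ f − E₂ f| ≤ Σ_{y ∈ Δ} a⋆_y δ_y(f)`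
  (`abs_sub_le_sum_of_superSolution_of_estimate`; the iterates satisfy
  `Φⁿ a₀ ≤ M cⁿ 𝟙_W + a⋆`);
* specification level: for `γ` with Dobrushin's condition in the Vasserstein form
  (`IsKRContraction γ r nbr C`), a finite volume `Λ`, `y ∉ Λ`, `ω = η` off `y`: the two kernels are
  invariant states with usable set `W = Λ` (`isInvariantState_kernel`), the vector
  `R·𝟙_Λ + r(ω_y, η_y)·𝟙_{y}` is an estimate (`isEstimate_kernel_pair`, properness), hence
  **`abs_kernel_sub_le_of_superSolution`**: for every `d ≥ 0` with `1 ≤ d_y`, supported in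
  `Λ ∪ {y}`, `Σ_{z ∈ nbr x} C x z d_z ≤ d_x` for `x ∈ Λ`, and `Σ_{z ∈ nbr x ∩ Λ} C x z ≤ c < 1`:
  `|∫ f dγ_Λ(·|ω) − ∫ f dγ_Λ(·|η)| ≤ r(ω_y, η_y) · Σ_{z ∈ Δ} d_z δ_z(f)` for bounded measurable `f`
  depending on `Δ` with coordinatewise `r`-Lipschitz bound `δ` — the window contraction of the
  kernel `γ_Λ` from SINGLE-SITE Dobrushin coefficients and the resolvent of `C` restricted to `Λ`
  (for `d = (I − C_{ΛΛ})⁻¹ C_{·y}` on `Λ`: Dobrushin–Shlosman's window coefficients from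
  Dobrushin's single-site ones).

References: R. L. Dobrushin, Theory Probab. Appl. 15 (1970) 458–486, Thm. 3; H. Föllmer, LNM 1362
(1988) Ch. I, (2.3), Lemma (2.5), (2.6)–(2.8), (2.10), Remark (2.17)–(2.22); H.-O. Georgii,
*Gibbs Measures and Phase Transitions* (2011), Def. 1.23 (consistency), Thm. 8.20.
-/

noncomputable section

open MeasureTheory ProbabilityTheory Finset Function Filter
open scoped Topology

namespace Literature.Probability.LatticeModels

namespace DobrushinMetric

namespace DustingData

variable {V S : Type*} [DecidableEq V] {D : DustingData V S}
variable {E₁ E₂ : ((V → S) → ℝ) → ℝ}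

/-! ### The sweep from a given estimate down to a super-solution -/

/-- `Φ` is monotone (the influence coefficients are nonnegative). [folklore] -/
private theorem phi_mono {a b : V → ℝ} (h : ∀ y, a y ≤ b y) (y : V) : D.phi a y ≤ D.phi b y := by
  by_cases hy : y ∈ D.W
  · rw [D.phi_apply_of_mem hy, D.phi_apply_of_mem hy]; exact D.rowC_mono h y
  · rw [D.phi_apply_of_not_mem hy, D.phi_apply_of_not_mem hy]; exact h y

/-- `rowC` is additive and homogeneous. [folklore] -/
private theorem rowC_add_smul (a e : V → ℝ) (t : ℝ) (x : V) :
    D.rowC (fun y => t * a y + e y) x = t * D.rowC a x + D.rowC e x := by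
  simp only [rowC, mul_add, Finset.sum_add_distrib, Finset.mul_sum]
  congr 1
  exact Finset.sum_congr rfl fun y _ => by ring

/-- All iterates `Φⁿ a₀` of a nonnegative estimate are nonnegative estimates (Föllmer 1988, Ch. I,
Lemma (2.5) applied successively). [cite: Follmer1988, Ch. I Lemma (2.5)] -/
theorem isEstimate_iterate_phi_of_estimate (h₁ : D.IsInvariantState E₁) (h₂ : D.IsInvariantState E₂)
    {a₀ : V → ℝ} (ha : D.IsEstimate E₁ E₂ a₀) (ha0 : ∀ y, 0 ≤ a₀ y) (n : ℕ) :
    D.IsEstimate E₁ E₂ (D.phi^[n] a₀) ∧ ∀ y, 0 ≤ (D.phi^[n] a₀) y := by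
  induction n with
  | zero => exact ⟨ha, ha0⟩
  | succ n ih =>
    rw [Function.iterate_succ_apply']
    exact ⟨ih.1.phi h₁ h₂ ih.2, D.phi_nonneg ih.2⟩

/-- **The iterates stay below `M cⁿ 𝟙_W + a⋆`** for a super-solution `a⋆ ≥ 0`
(`(C a⋆)_x ≤ a⋆_x` on `W`), an initial vector `a₀ ≤ M 𝟙_W + a⋆`, and `W`-restricted row sums
`(C 𝟙_W)_x ≤ c` on `W` (Föllmer 1988, Ch. I, after Lemma (2.5): `a Cⁿ⁺¹ + Σ_{m ≤ n} b C^m`).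
[cite: Follmer1988, Ch. I Comparison Theorem (2.8)] -/
theorem iterate_phi_le_of_superSolution {a₀ astar : V → ℝ}
    (hsol : ∀ x ∈ D.W, D.rowC astar x ≤ astar x) {M : ℝ} (hM : 0 ≤ M)
    (hinit : ∀ y, a₀ y ≤ M * Set.indicator D.W 1 y + astar y) {c : ℝ} (hc0 : 0 ≤ c)
    (hrowW : ∀ x ∈ D.W, D.rowC (Set.indicator D.W 1) x ≤ c) (n : ℕ) (y : V) :
    (D.phi^[n] a₀) y ≤ M * c ^ n * Set.indicator D.W 1 y + astar y := by
  induction n generalizing y with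
  | zero => simpa using hinit y
  | succ n ih =>
    rw [Function.iterate_succ_apply']
    refine (phi_mono ih y).trans ?_
    by_cases hy : y ∈ D.W
    · rw [D.phi_apply_of_mem hy, rowC_add_smul, Set.indicator_of_mem hy, Pi.one_apply, mul_one]
      calc M * c ^ n * D.rowC (Set.indicator D.W 1) y + D.rowC astar y
          ≤ M * c ^ n * c + astar y :=
            add_le_add (mul_le_mul_of_nonneg_left (hrowW y hy) (by positivity)) (hsol y hy)
        _ = M * c ^ (n + 1) + astar y := by ring
    · rw [D.phi_apply_of_not_mem hy, Set.indicator_of_notMem hy]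
      simp

/-- **Comparison estimate from a given estimate down to a super-solution** (Föllmer 1988, Ch. I,
Lemma (2.5)/(2.8) with the conditional specification (2.10): sites off `W` are never swept and
keep their initial coefficient). For two states invariant under the averaging operators at the
usable sites `W`, a nonnegative estimate `a₀`, a super-solution `a⋆ ≥ 0` (`(C a⋆)_x ≤ a⋆_x` for
`x ∈ W`) with `a₀ ≤ M 𝟙_W + a⋆`, and `W`-restricted row sums `≤ c < 1` on `W`, every admissible
`f` with dependence set `Δ` and Lipschitz bound `δ` vanishing off `Δ` satisfies
`|E₁ f − E₂ f| ≤ Σ_{y ∈ Δ} a⋆_y δ_y` (let `n → ∞` in `Φⁿ a₀ ≤ M cⁿ 𝟙_W + a⋆`).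
[cite: Follmer1988, Ch. I Comparison Theorem (2.8)] -/
theorem abs_sub_le_sum_of_superSolution_of_estimate (h₁ : D.IsInvariantState E₁)
    (h₂ : D.IsInvariantState E₂) {a₀ : V → ℝ} (ha : D.IsEstimate E₁ E₂ a₀) (ha0 : ∀ y, 0 ≤ a₀ y)
    {astar : V → ℝ} (hsol : ∀ x ∈ D.W, D.rowC astar x ≤ astar x)
    {M : ℝ} (hM : 0 ≤ M) (hinit : ∀ y, a₀ y ≤ M * Set.indicator D.W 1 y + astar y) {c : ℝ}
    (hc0 : 0 ≤ c) (hc1 : c < 1) (hrowW : ∀ x ∈ D.W, D.rowC (Set.indicator D.W 1) x ≤ c)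
    {f : (V → S) → ℝ} {Δ : Finset V} {δ : V → ℝ} (hf : D.P f Δ) (hδ : IsLipBound D.r f δ)
    (hδ0 : ∀ y ∉ Δ, δ y = 0) :
    |E₁ f - E₂ f| ≤ ∑ y ∈ Δ, astar y * δ y := by
  have hB : ∀ n : ℕ, |E₁ f - E₂ f| ≤ M * c ^ n * (∑ y ∈ Δ, δ y) + ∑ y ∈ Δ, astar y * δ y := by
    intro n
    obtain ⟨hest, -⟩ := isEstimate_iterate_phi_of_estimate h₁ h₂ ha ha0 n
    refine (hest hf hδ hδ0).trans ?_
    calc ∑ y ∈ Δ, (D.phi^[n] a₀) y * δ y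
        ≤ ∑ y ∈ Δ, (M * c ^ n * Set.indicator D.W 1 y + astar y) * δ y :=
          Finset.sum_le_sum fun y _ => mul_le_mul_of_nonneg_right
            (iterate_phi_le_of_superSolution hsol hM hinit hc0 hrowW n y) (hδ.nonneg y)
      _ ≤ ∑ y ∈ Δ, (M * c ^ n + astar y) * δ y := by
          refine Finset.sum_le_sum fun y _ => mul_le_mul_of_nonneg_right ?_ (hδ.nonneg y)
          have hind : Set.indicator D.W (1 : V → ℝ) y ≤ 1 := by
            by_cases hy : y ∈ D.W
            · rw [Set.indicator_of_mem hy, Pi.one_apply]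
            · rw [Set.indicator_of_notMem hy]; exact zero_le_one
          nlinarith [mul_nonneg hM (pow_nonneg hc0 n)]
      _ = M * c ^ n * (∑ y ∈ Δ, δ y) + ∑ y ∈ Δ, astar y * δ y := by
          rw [Finset.mul_sum, ← Finset.sum_add_distrib]
          exact Finset.sum_congr rfl fun y _ => by ring
  have hlim : Tendsto (fun n : ℕ => M * c ^ n * (∑ y ∈ Δ, δ y) + ∑ y ∈ Δ, astar y * δ y)
      atTop (𝓝 (0 + ∑ y ∈ Δ, astar y * δ y)) := by
    refine Tendsto.add_const _ ?_
    simpa using ((tendsto_pow_atTop_nhds_zero_of_lt_one hc0 hc1).const_mul M).mul_const _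
  rw [zero_add] at hlim
  exact ge_of_tendsto' hlim hB

end DustingData

/-! ### Specification level: two kernels of one volume with boundary conditions differing at one site -/

variable {V S : Type*} [MeasurableSpace S] {γ : Specification V S} {r : S → S → ℝ}
  {nbr : V → Finset V} {C : V → V → ℝ}

/-- **A finite-volume kernel is an invariant state with usable set its volume**: the functional
`f ↦ ∫ f dγ_Λ(·|ω)` is monotone-normalised and invariant under `γ_x` for every `x ∈ Λ`
(consistency; Föllmer 1988, Ch. I, (2.10): the conditional specification on `Λ` with the outside
frozen). [cite: Follmer1988, Ch. I (2.10)] -/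
theorem isInvariantState_kernel [DecidableEq V] (hγ : IsSpecification γ)
    (hC : IsKRContraction γ r nbr C) {R : ℝ} (hr0 : ∀ a b, 0 ≤ r a b) (hrR : ∀ a b, r a b ≤ R)
    (hR : 0 ≤ R) (Λ : Finset V) (ω : V → S) :
    (krDustingData hγ hC hr0 hrR hR (↑Λ : Set V)).IsInvariantState fun f => ∫ σ, f σ ∂(γ Λ ω) := by
  haveI := hγ.isProbability Λ ω
  refine ⟨fun {f Δ M} hf hM => ?_, fun {f Δ m} hf hm => ?_, fun {f Δ} x hx hf => ?_⟩
  · obtain ⟨hfm, -, B, hB⟩ := hf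
    calc ∫ σ, f σ ∂(γ Λ ω) ≤ ∫ _σ, M ∂(γ Λ ω) :=
          integral_mono (integrable_of_abs_le' hfm hB) (integrable_const M) hM
      _ = M := by simp
  · obtain ⟨hfm, -, B, hB⟩ := hf
    calc m = ∫ _σ, m ∂(γ Λ ω) := by simp
      _ ≤ ∫ σ, f σ ∂(γ Λ ω) :=
          integral_mono (integrable_const m) (integrable_of_abs_le' hfm hB) hm
  · obtain ⟨hfm, -, B, hB⟩ := hf
    exact hγ.integral_integral_consistent (Finset.singleton_subset_iff.2 hx) ω
      (integrable_of_abs_le' hfm hB)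

/-- Freezing one coordinate is measurable. [folklore] -/
private theorem measurable_update_const [DecidableEq V] (y : V) (c : S) :
    Measurable fun σ : V → S => Function.update σ y c := by
  refine measurable_pi_iff.2 fun z => ?_
  by_cases hz : z = y
  · subst hz
    simp only [Function.update_self]
    exact measurable_const
  · simp only [Function.update_of_ne hz]
    exact measurable_pi_apply z

/-- Two averages of a function with oscillation `≤ K` differ by at most `K`. [folklore] -/
private theorem abs_integral_sub_integral_le_of_osc {μ ν : Measure (V → S)} [IsProbabilityMeasure μ]
    [IsProbabilityMeasure ν] {h : (V → S) → ℝ} (hm : Measurable h) {B : ℝ} (hB : ∀ σ, |h σ| ≤ B)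
    {K : ℝ} (hosc : ∀ σ τ, |h σ - h τ| ≤ K) :
    |(∫ σ, h σ ∂μ) - ∫ τ, h τ ∂ν| ≤ K := by
  have hiμ : Integrable h μ := integrable_of_abs_le' hm hB
  have hiν : Integrable h ν := integrable_of_abs_le' hm hB
  have hpt : ∀ σ, |h σ - ∫ τ, h τ ∂ν| ≤ K := fun σ => by
    have e : h σ - ∫ τ, h τ ∂ν = ∫ τ, (h σ - h τ) ∂ν := by
      rw [integral_sub (integrable_const _) hiν, integral_const, smul_eq_mul, probReal_univ, one_mul]
    rw [e]
    calc |∫ τ, (h σ - h τ) ∂ν| ≤ ∫ τ, |h σ - h τ| ∂ν := abs_integral_le_integral_abs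
      _ ≤ ∫ _τ, K ∂ν := integral_mono ((integrable_const _).sub hiν).abs (integrable_const K)
          fun τ => hosc σ τ
      _ = K := by simp
  have e : (∫ σ, h σ ∂μ) - ∫ τ, h τ ∂ν = ∫ σ, (h σ - ∫ τ, h τ ∂ν) ∂μ := by
    rw [integral_sub hiμ (integrable_const _), integral_const, smul_eq_mul, probReal_univ, one_mul]
  rw [e]
  calc |∫ σ, (h σ - ∫ τ, h τ ∂ν) ∂μ| ≤ ∫ σ, |h σ - ∫ τ, h τ ∂ν| ∂μ := abs_integral_le_integral_abs
    _ ≤ ∫ _σ, K ∂μ := integral_mono (hiμ.sub (integrable_const _)).abs (integrable_const K) hpt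
    _ = K := by simp

/-- **The initial estimate for two boundary conditions differing at one exterior site**: for
`y ∉ Λ` and `ω = η` off `y`, the vector `R·𝟙_Λ + r(ω_y, η_y)·𝟙_{y}` is an estimate for the pair
`γ_Λ(·|ω)`, `γ_Λ(·|η)` — by properness both kernels freeze the outside, so `f` may be replaced by
`f(·^{y ← η_y})` at cost `δ_y(f) r(ω_y, η_y)` under the first kernel, and the two averages of a
function of the inside spins differ by at most its oscillation `R Σ_{z ∈ Λ} δ_z(f)`
(Föllmer 1988, Ch. I, (2.3) and (2.22)). [cite: Follmer1988, Ch. I (2.3)] -/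
theorem isEstimate_kernel_pair [DecidableEq V] (hγ : IsSpecification γ)
    (hC : IsKRContraction γ r nbr C) {R : ℝ} (hr0 : ∀ a b, 0 ≤ r a b) (hrR : ∀ a b, r a b ≤ R)
    (hR : 0 ≤ R) (Λ : Finset V) {y : V} (hy : y ∉ Λ) {ω η : V → S}
    (hωη : ∀ z, z ≠ y → ω z = η z) :
    (krDustingData hγ hC hr0 hrR hR (↑Λ : Set V)).IsEstimate (fun f => ∫ σ, f σ ∂(γ Λ ω))
      (fun f => ∫ σ, f σ ∂(γ Λ η))
      fun z => if z ∈ Λ then R else if z = y then r (ω y) (η y) else 0 := by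
  intro f Δ δ hf hδ hδ0
  obtain ⟨hfm, hfdep, B, hB⟩ := hf
  haveI := hγ.isProbability Λ ω
  haveI := hγ.isProbability Λ η
  -- the observable with the `y`-coordinate frozen to `η y`, and its inside version
  set g : (V → S) → ℝ := fun σ => f (Function.update σ y (η y)) with hg
  set glue : (V → S) → V → S := fun σ z => if z ∈ Λ then σ z else η z with hglue
  set h : (V → S) → ℝ := fun σ => g (glue σ) with hh
  have hupd := measurable_update_const (S := S) y (η y)
  have hglm : Measurable glue := by
    refine measurable_pi_iff.2 fun z => ?_
    by_cases hz : z ∈ Λ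
    · simp only [hglue, if_pos hz]; exact measurable_pi_apply z
    · simp only [hglue, if_neg hz]; exact measurable_const
  have hgm : Measurable g := hfm.comp hupd
  have hhm : Measurable h := hgm.comp hglm
  have hgB : ∀ σ, |g σ| ≤ B := fun σ => hB _
  have hhB : ∀ σ, |h σ| ≤ B := fun σ => hB _
  have hfi : ∀ ξ, Integrable f (γ Λ ξ) := fun ξ => by
    haveI := hγ.isProbability Λ ξ; exact integrable_of_abs_le' hfm hB
  have hgi : ∀ ξ, Integrable g (γ Λ ξ) := fun ξ => by
    haveI := hγ.isProbability Λ ξ; exact integrable_of_abs_le' hgm hgB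
  -- properness: under either kernel `g = h` a.e. (the outside is frozen, to `ω` resp. `η`, which
  -- agree off `y`, and `g` does not read `y`)
  have hgh : ∀ (ξ : V → S), (∀ z, z ≠ y → ξ z = η z) → ∀ᵐ σ ∂(γ Λ ξ), g σ = h σ := by
    intro ξ hξ
    filter_upwards [hγ.proper Λ ξ] with σ hσ
    simp only [hh, hg]
    congr 1
    funext z
    by_cases hzy : z = y
    · subst hzy; simp
    · rw [Function.update_of_ne hzy, Function.update_of_ne hzy]
      by_cases hzΛ : z ∈ Λ
      · simp only [hglue, if_pos hzΛ]
      · simp only [hglue, if_neg hzΛ]; rw [hσ z hzΛ, hξ z hzy]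
  -- under `γ_Λ(·|η)`: `f = g` a.e.
  have hη : ∫ σ, f σ ∂(γ Λ η) = ∫ σ, g σ ∂(γ Λ η) := by
    refine integral_congr_ae ?_
    filter_upwards [hγ.proper Λ η] with σ hσ
    simp only [hg]
    rw [← hσ y hy, Function.update_eq_self]
  -- under `γ_Λ(·|ω)`: `|f - g| ≤ δ_y r(ω_y, η_y)` a.e.
  have hω : |(∫ σ, f σ ∂(γ Λ ω)) - ∫ σ, g σ ∂(γ Λ ω)| ≤ δ y * r (ω y) (η y) := by
    rw [← integral_sub (hfi ω) (hgi ω)]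
    have hae : ∀ᵐ σ ∂(γ Λ ω), |f σ - g σ| ≤ δ y * r (ω y) (η y) := by
      filter_upwards [hγ.proper Λ ω] with σ hσ
      have h1 := hδ.le y σ (Function.update σ y (η y)) fun z hz => by
        rw [Function.update_of_ne hz]
      rw [Function.update_self, hσ y hy] at h1
      exact h1
    calc |∫ σ, (f σ - g σ) ∂(γ Λ ω)| ≤ ∫ σ, |f σ - g σ| ∂(γ Λ ω) := abs_integral_le_integral_abs
      _ ≤ ∫ _σ, δ y * r (ω y) (η y) ∂(γ Λ ω) :=
          integral_mono_ae ((hfi ω).sub (hgi ω)).abs (integrable_const _) hae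
      _ = δ y * r (ω y) (η y) := by simp
  -- the inside function `h` is `δ`-Lipschitz inside `Λ`, constant outside, and reads `Δ ∩ Λ`
  have hhLip : IsLipBound r h fun z => if z ∈ Λ then δ z else 0 := by
    refine ⟨fun z => by split_ifs; exacts [hδ.nonneg z, le_rfl], fun z σ τ hστ => ?_⟩
    by_cases hz : z ∈ Λ
    · rw [if_pos hz]
      have hgl : ∀ w, w ≠ z → Function.update (glue σ) y (η y) w =
          Function.update (glue τ) y (η y) w := by
        intro w hw
        by_cases hwy : w = y
        · subst hwy; simp
        · rw [Function.update_of_ne hwy, Function.update_of_ne hwy]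
          by_cases hwΛ : w ∈ Λ
          · simp only [hglue, if_pos hwΛ]; exact hστ w hw
          · simp only [hglue, if_neg hwΛ]
      have h1 := hδ.le z _ _ hgl
      have hzy : z ≠ y := fun h' => hy (h' ▸ hz)
      rw [Function.update_of_ne hzy, Function.update_of_ne hzy] at h1
      simp only [hglue, if_pos hz] at h1
      exact h1
    · rw [if_neg hz, zero_mul]
      have hst : glue σ = glue τ := by
        funext w
        by_cases hwΛ : w ∈ Λ
        · simp only [hglue, if_pos hwΛ]
          exact hστ w fun h' => hz (h' ▸ hwΛ)
        · simp only [hglue, if_neg hwΛ]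
      simp only [hh, hst, sub_self, abs_zero, le_refl]
  have hhdep : DependsOn h (↑(Δ.filter fun z => z ∈ Λ) : Set V) := by
    intro σ τ hστ
    simp only [hh, hg]
    refine hfdep fun w hw => ?_
    by_cases hwy : w = y
    · subst hwy; simp
    · rw [Function.update_of_ne hwy, Function.update_of_ne hwy]
      by_cases hwΛ : w ∈ Λ
      · simp only [hglue, if_pos hwΛ]
        exact hστ w (by simp [Finset.mem_coe.1 hw, hwΛ])
      · simp only [hglue, if_neg hwΛ]
  have hosc : ∀ σ τ, |h σ - h τ| ≤ R * ∑ z ∈ Δ.filter (fun z => z ∈ Λ), δ z := by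
    intro σ τ
    have h1 := abs_sub_le_mul_sum_of_dependsOn hrR hhdep (hhLip.restrict hhdep) σ τ
    refine h1.trans (le_of_eq ?_)
    congr 1
    refine Finset.sum_congr rfl fun z hz => ?_
    rw [Finset.mem_filter] at hz
    rw [if_pos (Finset.mem_filter.2 hz), if_pos hz.2]
  have hin : |(∫ σ, g σ ∂(γ Λ ω)) - ∫ σ, g σ ∂(γ Λ η)| ≤
      R * ∑ z ∈ Δ.filter (fun z => z ∈ Λ), δ z := by
    rw [integral_congr_ae (hgh ω hωη), integral_congr_ae (hgh η fun _ _ => rfl)]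
    exact abs_integral_sub_integral_le_of_osc hhm hhB hosc
  -- assemble
  have hsum : ∑ z ∈ Δ, (if z ∈ Λ then R else if z = y then r (ω y) (η y) else 0) * δ z =
      R * ∑ z ∈ Δ.filter (fun z => z ∈ Λ), δ z + if y ∈ Δ then r (ω y) (η y) * δ y else 0 := by
    have hpt : ∀ z ∈ Δ, (if z ∈ Λ then R else if z = y then r (ω y) (η y) else 0) * δ z =
        (if z ∈ Λ then R * δ z else 0) + if z = y then r (ω y) (η y) * δ z else 0 := by
      intro z _
      by_cases hzΛ : z ∈ Λ
      · have hzy : z ≠ y := fun h' => hy (h' ▸ hzΛ)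
        rw [if_pos hzΛ, if_pos hzΛ, if_neg hzy, add_zero]
      · rw [if_neg hzΛ, if_neg hzΛ, zero_add]
        by_cases hzy : z = y
        · rw [if_pos hzy, if_pos hzy]
        · rw [if_neg hzy, if_neg hzy, zero_mul]
    rw [Finset.sum_congr rfl hpt, Finset.sum_add_distrib, ← Finset.sum_filter, Finset.sum_ite_eq',
      ← Finset.mul_sum]
  have hyterm : δ y * r (ω y) (η y) ≤ if y ∈ Δ then r (ω y) (η y) * δ y else 0 := by
    split_ifs with hyΔ
    · rw [mul_comm]
    · rw [hδ0 y hyΔ, zero_mul]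
  change |(∫ σ, f σ ∂(γ Λ ω)) - ∫ σ, f σ ∂(γ Λ η)| ≤ _
  rw [hsum, hη]
  calc |(∫ σ, f σ ∂(γ Λ ω)) - ∫ σ, g σ ∂(γ Λ η)|
      ≤ |(∫ σ, f σ ∂(γ Λ ω)) - ∫ σ, g σ ∂(γ Λ ω)| + |(∫ σ, g σ ∂(γ Λ ω)) - ∫ σ, g σ ∂(γ Λ η)| :=
        abs_sub_le _ _ _
    _ ≤ δ y * r (ω y) (η y) + R * ∑ z ∈ Δ.filter (fun z => z ∈ Λ), δ z := add_le_add hω hin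
    _ ≤ R * ∑ z ∈ Δ.filter (fun z => z ∈ Λ), δ z + if y ∈ Δ then r (ω y) (η y) * δ y else 0 := by
        rw [add_comm]; exact add_le_add le_rfl hyterm

/-- **Dobrushin's comparison of two boundary conditions, window form.** Let `γ` satisfy
Dobrushin's condition in the Vasserstein form (`IsKRContraction γ r nbr C`, `0 ≤ r ≤ R`), `Λ` a
finite volume, `y ∉ Λ`, and `ω = η` off `y`. Let `d ≥ 0` with `1 ≤ d_y` be a super-solution on
`Λ`: `Σ_{z ∈ nbr x} C x z · d_z ≤ d_x` for `x ∈ Λ` (e.g. `d = 𝟙_{y} + (I − C_{ΛΛ})⁻¹ C_{Λ y}`), and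
let the `Λ`-restricted row sums satisfy `Σ_{z ∈ nbr x, z ∈ Λ} C x z ≤ c < 1` on `Λ`. Then for every
bounded measurable `f` depending on `Δ` with coordinatewise `r`-Lipschitz bound `δ`:
`|∫ f dγ_Λ(·|ω) − ∫ f dγ_Λ(·|η)| ≤ r(ω_y, η_y) · Σ_{z ∈ Δ} d_z δ_z` (Dobrushin 1970 Thm. 3;
Föllmer 1988 Ch. I (2.8) with (2.10): the window (block) Kantorovich coefficients of `γ_Λ` from
the single-site ones through the resolvent restricted to `Λ`). [cite: Follmer1988, Ch. I Comparison Theorem (2.8)] -/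
theorem abs_kernel_sub_le_of_superSolution [DecidableEq V] (hγ : IsSpecification γ)
    (hC : IsKRContraction γ r nbr C) {R : ℝ} (hr0 : ∀ a b, 0 ≤ r a b) (hrR : ∀ a b, r a b ≤ R)
    (hR : 0 ≤ R) (Λ : Finset V) {y : V} (hy : y ∉ Λ) {ω η : V → S}
    (hωη : ∀ z, z ≠ y → ω z = η z) {d : V → ℝ} (hd0 : ∀ z, 0 ≤ d z) (hdy : 1 ≤ d y)
    (hsol : ∀ x ∈ Λ, ∑ z ∈ nbr x, C x z * d z ≤ d x) {c : ℝ} (hc0 : 0 ≤ c) (hc1 : c < 1)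
    (hrowW : ∀ x ∈ Λ, ∑ z ∈ nbr x, (if z ∈ Λ then C x z else 0) ≤ c)
    {f : (V → S) → ℝ} (hfm : Measurable f) {Δ : Finset V} (hfdep : DependsOn f (↑Δ : Set V))
    {M : ℝ} (hM : ∀ σ, |f σ| ≤ M) {δ : V → ℝ} (hδ : IsLipBound r f δ) :
    |(∫ σ, f σ ∂(γ Λ ω)) - ∫ σ, f σ ∂(γ Λ η)| ≤ r (ω y) (η y) * ∑ z ∈ Δ, d z * δ z := by
  set D := krDustingData hγ hC hr0 hrR hR (↑Λ : Set V) with hD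
  have h₁ := isInvariantState_kernel hγ hC hr0 hrR hR Λ ω
  have h₂ := isInvariantState_kernel hγ hC hr0 hrR hR Λ η
  have ha := isEstimate_kernel_pair hγ hC hr0 hrR hR Λ hy hωη
  have hry : 0 ≤ r (ω y) (η y) := hr0 _ _
  have hrowC : ∀ (a : V → ℝ) (x : V), D.rowC a x = ∑ z ∈ nbr x, C x z * a z := fun a x => by
    change ∑ z ∈ nbr x, (if z ∈ nbr x then C x z else 0) * a z = _
    exact Finset.sum_congr rfl fun z hz => by rw [if_pos hz]
  have key := DustingData.abs_sub_le_sum_of_superSolution_of_estimate h₁ h₂ ha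
    (fun z => by
      show 0 ≤ (if z ∈ Λ then R else if z = y then r (ω y) (η y) else 0)
      split_ifs; exacts [hR, hry, le_rfl])
    (astar := fun z => r (ω y) (η y) * d z)
    (fun x hx => by
      rw [hrowC]
      have hx' : x ∈ Λ := hx
      calc ∑ z ∈ nbr x, C x z * (r (ω y) (η y) * d z)
          = r (ω y) (η y) * ∑ z ∈ nbr x, C x z * d z := by
            rw [Finset.mul_sum]; exact Finset.sum_congr rfl fun z _ => by ring
        _ ≤ r (ω y) (η y) * d x := mul_le_mul_of_nonneg_left (hsol x hx') hry)
    (M := R) hR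
    (fun z => by
      show (if z ∈ Λ then R else if z = y then r (ω y) (η y) else 0) ≤
        R * Set.indicator D.W 1 z + r (ω y) (η y) * d z
      by_cases hzΛ : z ∈ Λ
      · rw [if_pos hzΛ, Set.indicator_of_mem (show z ∈ D.W from Finset.mem_coe.2 hzΛ), Pi.one_apply,
          mul_one]
        exact le_add_of_nonneg_right (mul_nonneg hry (hd0 z))
      · rw [if_neg hzΛ, Set.indicator_of_notMem (show z ∉ D.W from fun h' => hzΛ (Finset.mem_coe.1 h')),
          mul_zero, zero_add]
        by_cases hzy : z = y
        · subst hzy; rw [if_pos rfl]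
          exact le_mul_of_one_le_right hry hdy
        · rw [if_neg hzy]; exact mul_nonneg hry (hd0 z))
    hc0 hc1
    (fun x hx => by
      rw [hrowC]
      have hx' : x ∈ Λ := hx
      refine le_trans (le_of_eq (Finset.sum_congr rfl fun z _ => ?_)) (hrowW x hx')
      by_cases hzΛ : z ∈ Λ
      · rw [if_pos hzΛ, Set.indicator_of_mem (show z ∈ D.W from Finset.mem_coe.2 hzΛ), Pi.one_apply,
          mul_one]
      · rw [if_neg hzΛ, Set.indicator_of_notMem (show z ∉ D.W from fun h' => hzΛ (Finset.mem_coe.1 h')),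
          mul_zero])
    (f := f) (Δ := Δ) ⟨hfm, hfdep, M, hM⟩ (hδ.restrict hfdep) (fun z hz => if_neg hz)
  refine key.trans (le_of_eq ?_)
  rw [Finset.mul_sum]
  refine Finset.sum_congr rfl fun z hz => ?_
  rw [if_pos hz]
  ring

end DobrushinMetric

end Literature.Probability.LatticeModels

end
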